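import Summits.Parity.GeneralizedHardyLittlewood.Theses.LeeYangFibres
import Literature.Barriers.Parity.SiegelZeroPrimePairs
import Literature.Barriers.Parity.SiegelZeroDichotomy
import HarnessLib

/-!
# Crux `PrimeCellsRelative` (stmt-Parity-14112, route `LeeYangFibres`) — ideator 2, round 1: first lemmas

Sketch file of planner-cruxidea-stmt-Parity-14112-2-0 (crux-ideate). Two cards:

* `crux-locator` — WHERE THE CRUX LIVES. `PrimeCellsRelative` (counting Dickson–Hardy–Littlewood for
  rough prime cells, Green–Tao Conj. 1.4 error shape) is EQUIVALENT to the route's next node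
  `RelativeDimOne` (down: item 14115 `CellsToRelativeDimOne`, PROVED in the tree,
  `Theorems/LeeYangFibresCellsToRelativeDimOne`; up: `primeCellsRelative_of_relativeDimOne` below,
  provable now by the same sandwich run forwards), is implied by the shared target `DimOne`
  (stmt-Parity-0819; `relativeDimOne_of_dimOne` PROVED in `Theorems/LeeYangFibresRelativeDimOne`),
  contains a Landau–Siegel statement through its shift-uniformity alone
  (`not_unboundedSiegelZeros_of_primeCellsRelative`), and its fixed-shape (Siegel-consistent) core
  is inside the summit's OTHER conjunct (`fixedShapeCells_of_batemanHorn`).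
* `accessible-face` — THE w = 1 FACE IS BOMBIERI–VINOGRADOV TERRITORY. The mixed counts "one
  coordinate prime, the other t - 1 merely N^{1/u}-rough" (`OnePrimeRung`) are provable now,
  uniformly in ‖Ψ‖_N ≤ L (Siegel–Walfisz for the fixed modulus a_i ≤ L, Bombieri–Vinogradov for
  the sifting moduli, the fundamental lemma at s = u·(1/2 - δ) → ∞ — the crux's ∃u is exactly what
  makes the fundamental lemma exact); they give the t = 1 case of the crux
  (`primeCellsRelativeAt_one`) and, fed into `CellParityLaw`, clip every SINGLETON Walsh amplitude
  θ_{i} without any zero-locus input (`cellParityLaw_singletonFree`); the remaining content of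
  the crux is the amplitudes θ_S, |S| ≥ 2, which the w = 1 face sees only damped by Alladi's
  parity-balance ratio ρ₁(u)^{|S|-1} → 0 — they live on the w → 0 faces (binary content).

Everything is stated over the route file's declarations and the tree; `sorry` marks statements that
are provable now (sizes in the docstrings) or named-fact-conditional; the pure-logic lemmas are proved; two
`sorry`s stand for tree theorems whose modules were unbuilt on the farm snapshot (named inline).
-/

noncomputable section

namespace Summit.Parity.GeneralizedHardyLittlewood.Cruxes.PrimeCellsRelative.Ideator2

open scoped BigOperators Topology Classical
open Filter Finset Literature.NumberTheory.Sieve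
open Summit.Parity.GeneralizedHardyLittlewood.Theses.LeeYangFibres
open Literature.Barriers.Parity (MatomakiMerikoski2023_pairCorrelation UnboundedSiegelZeros)

/-! ## Card `crux-locator` -/

/-- The crux at a FIXED number of forms `t` (the route decl `PrimeCellsRelative` quantifies
`∀ (t L : ℕ), 1 ≤ t → …`; here `t` is a parameter and the body is copied verbatim). -/
def PrimeCellsRelativeAt (t : ℕ) : Prop :=
  ∀ L : ℕ, ∀ ε : ℝ, 0 < ε → ∃ u : ℕ, 2 ≤ u ∧ ∃ N₀ : ℕ, ∀ N : ℕ, N₀ ≤ N → ∀ Ψ : Fin t → Literature.NumberTheory.Sieve.AffLinForm 1, Literature.NumberTheory.Sieve.IsNondegenerateSystem Ψ → Literature.NumberTheory.Sieve.affLinSize Ψ N ≤ L → ∀ K : Set (Fin 1 → ℝ), Convex ℝ K → K ⊆ Literature.NumberTheory.Sieve.realBox 1 N → |((((Literature.NumberTheory.Sieve.latticeBox 1 N).filter (fun n => Literature.NumberTheory.Sieve.realPoint n ∈ K ∧ ∀ i, (N : ℝ) ^ ((1 : ℝ) / u) < (Nat.minFac ((Ψ i).eval n).toNat : ℝ) ∧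 ArithmeticFunction.cardFactors ((Ψ i).eval n).toNat = 1)).card : ℕ) : ℝ) - Literature.NumberTheory.Sieve.archFactor Ψ K * Literature.NumberTheory.Sieve.singularProduct Ψ * (((((Finset.Icc 1 N).filter (fun m => (N : ℝ) ^ ((1 : ℝ) / u) < (Nat.minFac m : ℝ) ∧ ArithmeticFunction.cardFactors m = 1)).card : ℕ) : ℝ) / N) ^ t| ≤ ε * (Literature.NumberTheory.Sieve.archFactor Ψ K * Literature.NumberTheory.Sieve.singularProduct Ψ * (((((Finset.Icc 1 N).filter (fun m => (N : ℝ) ^ ((1 : ℝ) / u) < (Nat.minFac m : ℝ) ∧ ArithmeticFunction.cardFactors m = 1)).card : ℕ) : ℝ) / N) ^ t + N / Real.log N ^ t)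

/-- Slicing the crux by the number of forms (pure logic, PROVED). -/
theorem primeCellsRelative_iff_forall :
    PrimeCellsRelative ↔ ∀ t : ℕ, 1 ≤ t → PrimeCellsRelativeAt t := by
  constructor
  · intro h t ht L ε hε
    exact h t L ht ε hε
  · intro h t L ht ε hε
    exact h t ht L ε hε

/-- **Location lemma L1 (down + absolute ⇒ relative), PROVED from the tree.**
`DimOne → RelativeDimOne` is `Theorems/LeeYangFibresRelativeDimOne.relativeDimOne_of_dimOne`
(sorry-free); `PrimeCellsRelative → RelativeDimOne` is item 14115, proved in
`Theorems/LeeYangFibresCellsToRelativeDimOne.cellsToRelativeDimOne_proof` (sorry-free). -/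
theorem relativeDimOne_of_dimOne' : DimOne → RelativeDimOne := by
  -- PROVED in the tree (sorry-free): `Summit.Parity.GeneralizedHardyLittlewood.Theorems.
  -- LeeYangFibresRelativeDimOne.relativeDimOne_of_dimOne`; not imported here only because the farm
  -- snapshot had that Theorems module unbuilt at check time (remote:stale:unbuilt).
  sorry

/-- The down-transfer, by name (item 14115, PROVED in the tree). -/
theorem relativeDimOne_of_primeCellsRelative : PrimeCellsRelative → RelativeDimOne := by
  -- = item 14115 `CellsToRelativeDimOne`, PROVED in the tree (sorry-free):
  -- `Summit.Parity.GeneralizedHardyLittlewood.Theorems.LeeYangFibresCells.cellsToRelativeDimOne_proof`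
  -- (file Theorems/LeeYangFibresCellsToRelativeDimOne.lean); same import caveat as above.
  sorry

/-- **Location lemma L1 (up): `RelativeDimOne → PrimeCellsRelative`** — the Λ-form with
Green–Tao's relative + absolute error gives back the rough prime cells with the same error shape.
PROVABLE NOW (size L, ≈ 250 lines): run the sandwich
`Literature.NumberTheory.Sieve.vonMangoldtSum_primePointCount_sandwich` FORWARDS exactly as
`Literature.NumberTheory.Sieve.primePointCount_asymptotic_of_vonMangoldtSum_asymptotic`
(`LinearEquationsInPrimesCount.lean`, which does it for the absolute input `ε N^d`) with the
relative input `ε (β_∞∏β_p + N)` (the bookkeeping `count_arith` only uses `|S - M| ≤ ε'·X` with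
`X := M + N` in place of `N`), then pass from prime points to rough prime cells with
`card_cells_le_primePointCount` / `primePointCount_le_card_cells_add` (`C ≤ P ≤ C + t(2N^{1/u}+1)`)
and from `1/log^t N` to `(A₁/N)^t` with `eventually_primeCounting_window`
(`Theorems/LeeYangFibresCellsToRelativeDimOneCounts`; PNT is proved in the tree). Any `u ≥ 2`
works (the crux's `∃ u` is cosmetic: `π(N) - N^{1/u} ≤ A₁ ≤ π(N)`). -/
theorem primeCellsRelative_of_relativeDimOne : RelativeDimOne → PrimeCellsRelative := by
  sorry

/-- Hence the crux COLLAPSES onto its successor node: `PrimeCellsRelative ↔ RelativeDimOne`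
(items 14112 ≡ 14113), modulo the provable up-transfer. -/
theorem primeCellsRelative_iff_relativeDimOne : PrimeCellsRelative ↔ RelativeDimOne :=
  ⟨relativeDimOne_of_primeCellsRelative, primeCellsRelative_of_relativeDimOne⟩

/-- … and is a COROLLARY of the shared target stmt-Parity-0819 (`DimOne`, wanted by
DicksonFibration / PrimeDeterminantCells / HyperbolicConstellations / LeeYangFibres): the glue
`DimOne → PrimeCellsRelative` that should be filed as a support so that 14112 closes with 0819. -/
theorem primeCellsRelative_of_dimOne : DimOne → PrimeCellsRelative :=
  fun h => primeCellsRelative_of_relativeDimOne (relativeDimOne_of_dimOne' h)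

/-- **Location lemma L2 (Landau–Siegel content of the crux).** Shift-uniformity `|b_i| ≤ LN`
alone makes the crux exclude Siegel zeros of unbounded quality: at a quality-η zero of conductor
`q`, Matomäki–Merikoski Thm 1.3 (tree fact `MatomakiMerikoski2023_pairCorrelation`) DOUBLES the
main term of `Σ_{n≤X} Λ(n)Λ(n+h)` at `h = q` (even `q`; `h = 2q` for odd `q`), `X = q^{10}`,
which contradicts `RelativeDimOne` at `t = 2, L = 4, ε = 1/10` — this is
`Cruxes/AbsoluteUpgrade/SketchIdeator1.not_unboundedSiegelZeros_of_relativeDimOne` (typed there,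
provable now modulo the named fact, size M) composed with item 14115 (PROVED). Consequence for
every line: some stub must carry a Siegel-repelling input; the card `accessible-face` puts it in
the |S| ≥ 2 amplitudes (its rungs are Siegel–Walfisz/BV theorems). -/
theorem not_unboundedSiegelZeros_of_primeCellsRelative
    (_hMM : MatomakiMerikoski2023_pairCorrelation)
    (hR : RelativeDimOne → ¬ UnboundedSiegelZeros) :
    PrimeCellsRelative → ¬ UnboundedSiegelZeros :=
  fun hP => hR (relativeDimOne_of_primeCellsRelative hP)

/-- The FIXED-SHAPE core of the crux: the system `Ψ` is fixed BEFORE the scale `N` (no uniformity in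
the shifts), the body `K ⊆ [-N, N]` stays uniform. This is the Siegel-CONSISTENT part
(Matomäki–Merikoski Cor. 1.1(i), tree fact `MatomakiMerikoski2023_fixedShift`, PROVES fixed-shift
Hardy–Littlewood near every exceptional conductor). -/
def FixedShapeCells : Prop :=
  ∀ t : ℕ, 1 ≤ t → ∀ Ψ : Fin t → AffLinForm 1, IsNondegenerateSystem Ψ → ∀ ε : ℝ, 0 < ε →
    ∃ u : ℕ, 2 ≤ u ∧ ∃ N₀ : ℕ, ∀ N : ℕ, N₀ ≤ N → ∀ K : Set (Fin 1 → ℝ), Convex ℝ K →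
      K ⊆ realBox 1 N →
        |((((latticeBox 1 N).filter (fun n => realPoint n ∈ K ∧ ∀ i,
            (N : ℝ) ^ ((1 : ℝ) / u) < (Nat.minFac ((Ψ i).eval n).toNat : ℝ) ∧
              ArithmeticFunction.cardFactors ((Ψ i).eval n).toNat = 1)).card : ℕ) : ℝ) -
          archFactor Ψ K * singularProduct Ψ *
            (((((Finset.Icc 1 N).filter (fun m => (N : ℝ) ^ ((1 : ℝ) / u) < (Nat.minFac m : ℝ) ∧
              ArithmeticFunction.cardFactors m = 1)).card : ℕ) : ℝ) / N) ^ t| ≤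
        ε * (archFactor Ψ K * singularProduct Ψ *
            (((((Finset.Icc 1 N).filter (fun m => (N : ℝ) ^ ((1 : ℝ) / u) < (Nat.minFac m : ℝ) ∧
              ArithmeticFunction.cardFactors m = 1)).card : ℕ) : ℝ) / N) ^ t + N / Real.log N ^ t)

/-- The crux contains its fixed-shape core (take `L := Σ|a_i| + Σ|b_i|`, so that `‖Ψ‖_N ≤ L` for
all `N ≥ 1`). Provable now (XS bookkeeping on `affLinSize`). -/
theorem fixedShapeCells_of_primeCellsRelative : PrimeCellsRelative → FixedShapeCells := by
  sorry

/-- **Location lemma L3 (the core is inside the OTHER conjunct).** The Bateman–Horn conjecture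
(`Summit.Parity.BatemanHorn` = `Literature.NumberTheory.Sieve.BatemanHornConjecture`, fixed
polynomial systems, `x → ∞`) applied to the LINEAR polynomials `f_i = a_i X + b_i` gives
`FixedShapeCells`: positive slopes — BH on `[1, x]` at `x = sup K` and `x = inf K` and subtract
(the difference of `C x / log^t x` at two points `≤ N` is controlled by the absolute slack
`ε N / log^t N`); all slopes negative — reflect `n ↦ -n` (`K ↦ -K` convex, box symmetric); slopes
of both signs — the positivity region `{ψ_i > 0 ∀ i}` is a FIXED bounded interval, count and main
term are `O_Ψ(1)`; a fixed prime divisor — `β_p = 0`, `∏β_p = 0`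
(`tendsto_singularProductPartial_holds`), and at most `O(t²)` prime points. Provable now (M/L),
via the tree's `IsBatemanHornSystem` / `BatemanHornAsymptotic` dictionary
(`ParityBatemanHorn.lean`; cf. `dicksonConjecture_of_batemanHornConjecture`). So the part of the
crux NOT already owed by the summit's first conjunct is pure SHAPE-UNIFORMITY (shapes growing with
N: Goldbach-type + Landau–Siegel, L2). -/
theorem fixedShapeCells_of_batemanHorn :
    Literature.NumberTheory.Sieve.BatemanHornConjecture → FixedShapeCells := by
  sorry

/-! ## Card `accessible-face` -/

/-- `Φ_u(N) = #{m ≤ N : P⁻(m) > N^{1/u}}`, the rough-integer count (model fibre value `F_N(1)·N`). -/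
def roughCount (N u : ℕ) : ℕ :=
  ((Finset.Icc 1 N).filter (fun m => (N : ℝ) ^ ((1 : ℝ) / u) < (Nat.minFac m : ℝ))).card

/-- `A₁(N) = #{m ≤ N : P⁻(m) > N^{1/u}, Ω(m) = 1} = π(N) - π(N^{1/u})`. -/
def roughPrimes (N u : ℕ) : ℕ :=
  ((Finset.Icc 1 N).filter (fun m => (N : ℝ) ^ ((1 : ℝ) / u) < (Nat.minFac m : ℝ) ∧
    ArithmeticFunction.cardFactors m = 1)).card

/-- The ONE-PRIME RUNG count: coordinate `i` is a prime `> N^{1/u}`, every coordinate (including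
`i`) is `N^{1/u}`-rough. In the route's language: the sum of the joint cells `C_j` over all `j`
with `j_i = 1`, i.e. the `ζ¹`-coefficient of the `i`-th fibre polynomial at frozen fugacities
`w = (1, …, 1)`. -/
def onePrimeCount {t : ℕ} (Ψ : Fin t → AffLinForm 1) (K : Set (Fin 1 → ℝ)) (N u : ℕ)
    (i : Fin t) : ℕ :=
  ((latticeBox 1 N).filter (fun n => realPoint n ∈ K ∧
    (∀ k, (N : ℝ) ^ ((1 : ℝ) / u) < (Nat.minFac ((Ψ k).eval n).toNat : ℝ)) ∧
      ArithmeticFunction.cardFactors ((Ψ i).eval n).toNat = 1)).card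

/-- **`OnePrimeRung t`** — the mixed asymptotic, uniform in the system and the body, for ALL large
roughness degrees `u ≥ u₀(ε)`: `#{n ∈ K : ψ_i(n) prime > N^{1/u}, ψ_k(n) N^{1/u}-rough ∀ k}
= β_∞ ∏_p β_p · (A₁/N) · (Φ_u/N)^{t-1} · (1 ± ε) ± ε N/log^t N`. The main term is the route's
independent-anatomy model summed over the free cells (`Σ_j A_j = Φ_u`). Provable now (XL):
primes `p = ψ_i(n)` in the progression `b_i mod a_i` on the interval `ψ_i(K)` (Siegel–Walfisz,
fixed modulus `|a_i| ≤ L`: tree `siegel_walfisz_holds`), sieved for the `t - 1` conditions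
`q ∤ ψ_k(n)`, `q ≤ N^{1/u}`, a sieve of dimension `t - 1` on a set of primes with level
`N^{1/2}/log^B` (Bombieri–Vinogradov, tree `bombieri_vinogradov_holds`, uniform over residues) at
parameter `s = log D/log z = u(1/2 - o(1)) → ∞`, where the fundamental lemma is an ASYMPTOTIC
with relative error `C(κ, K) e^{-s}` in the tree's form (`SieveSequence.fundamental_lemma_uniform_holds`,
uniform over `HasSieveDimension`, `g(p) = 0` allowed; `e^{-s log s + O(s log log s)}` in Greaves, Sieves in
Number Theory, §3.3 Cor. 1.2; BV in sieve form ibid. §1.2.6 Lemma 1); the local densities of the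
sifted prime set multiply out to `∏_p β_p · ∏_{p ≤ z}(1-1/p)^{t-1}` up to `(1 + O(ρ(u)))` and
`Φ_u/N = (e^γ ω(u) + o(1)) ∏_{p≤z}(1-1/p)` with `e^γ ω(u) = 1 + O(ρ(u))` (de Bruijn/Buchstab, tree
`RoughNumbersBuchstab`). Shift divisors (the `TupleElliott` refutation pattern, negatives index) only
change the local densities, which the fundamental lemma handles uniformly in the dimension class. -/
def OnePrimeRung (t : ℕ) : Prop :=
  ∀ L : ℕ, ∀ ε : ℝ, 0 < ε → ∃ u₀ : ℕ, ∀ u : ℕ, u₀ ≤ u → ∃ N₀ : ℕ, ∀ N : ℕ, N₀ ≤ N →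
    ∀ Ψ : Fin t → AffLinForm 1, IsNondegenerateSystem Ψ → affLinSize Ψ N ≤ L →
      ∀ K : Set (Fin 1 → ℝ), Convex ℝ K → K ⊆ realBox 1 N → ∀ i : Fin t,
        |(onePrimeCount Ψ K N u i : ℝ) -
            archFactor Ψ K * singularProduct Ψ * ((roughPrimes N u : ℝ) / N) *
              ((roughCount N u : ℝ) / N) ^ (t - 1)| ≤
          ε * (archFactor Ψ K * singularProduct Ψ * ((roughPrimes N u : ℝ) / N) *
              ((roughCount N u : ℝ) / N) ^ (t - 1) + N / Real.log N ^ t)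

/-- The rung is a THEOREM-to-be for every `t` (XL; inputs listed at `OnePrimeRung`). -/
theorem onePrimeRung_holds (t : ℕ) (ht : 1 ≤ t) : OnePrimeRung t := by
  sorry

/-- **First consequence: the `t = 1` case of the crux** (primes `> N^{1/u}` in a progression
segment `a n + b`, `|a| ≤ L`, `|b| ≤ LN`, `n ∈ K`), from the rung at `t = 1` (there
`(Φ_u/N)^0 = 1` and the roughness condition on the prime coordinate is automatic) — or directly
from Siegel–Walfisz. Provable now (S given the rung; M directly). -/
theorem primeCellsRelativeAt_one : PrimeCellsRelativeAt 1 := by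
  sorry

/-- `CellParityLaw` with the SINGLETON amplitudes clipped: the route's law verbatim plus the
conjunct `∀ i, |θ {i}| ≤ ε`. -/
def CellParityLawSingletonFree : Prop :=
  ∀ (t L u : ℕ), 1 ≤ t → 2 ≤ u → ∀ ε : ℝ, 0 < ε → ∃ u₁ : ℕ, u ≤ u₁ ∧ ∃ N₀ : ℕ, ∀ N : ℕ, N₀ ≤ N → ∀ Ψ : Fin t → Literature.NumberTheory.Sieve.AffLinForm 1, Literature.NumberTheory.Sieve.IsNondegenerateSystem Ψ → Literature.NumberTheory.Sieve.affLinSize Ψ N ≤ L → ∀ K : Set (Fin 1 → ℝ), Convex ℝ K → K ⊆ Literature.NumberTheory.Sieve.realBox 1 N → ∃ θ : Finset (Fin t) → ℝ, θ ∅ = 1 ∧ (∀ S, |θ S| ≤ 2) ∧ (∀ i : Fin t, |θ {i}| ≤ ε) ∧ ∀ j : Fin t → ℕ, (∀ i, 1 ≤ j i ∧ j i ≤ u₁) → |((((Literature.NumberTheory.Sieve.latticeBox 1 N).filter (fun n => Literature.NumberTheory.Sieve.realPoint n ∈ K ∧ ∀ i, (N : ℝ) ^ ((1 : ℝ) / u₁)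 < (Nat.minFac ((Ψ i).eval n).toNat : ℝ) ∧ ArithmeticFunction.cardFactors ((Ψ i).eval n).toNat = j i)).card : ℕ) : ℝ) - (∑ S : Finset (Fin t), θ S * ∏ i ∈ S, (-1 : ℝ) ^ (j i + 1)) * (Literature.NumberTheory.Sieve.archFactor Ψ K * Literature.NumberTheory.Sieve.singularProduct Ψ * ∏ i, ((((Finset.Icc 1 N).filter (fun m => (N : ℝ) ^ ((1 : ℝ) / u₁) < (Nat.minFac m : ℝ) ∧ ArithmeticFunction.cardFactors m = j i)).card : ℕ) : ℝ) / N)| ≤ ε * N / Real.log N ^ t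

/-- **Second consequence: singleton clipping without hyperbolicity.** At frozen fugacities
`w = (1,…,1)` the `i`-th fibre polynomial of the law is
`P_i(ζ) = M F_N(1)^{t-1} Σ_m a_m ζ^m [α_i + (-1)^{m+1} β_i] + E(ζ)` with
`α_i = Σ_{S ∌ i} θ_S ρ₁^{|S|}`, `β_i = Σ_{S ∋ i} θ_S ρ₁^{|S|-1}`, `ρ₁ = ρ₁(u, N) := -F_N(-1)/F_N(1)`,
`F_N(w) = Σ_j (A_j(N)/N) w^j`; its `ζ¹`-coefficient is the one-prime count. `OnePrimeRung` pins
`α_i + β_i = 1 + O(ε)`, the `ζ^m`-coefficients for two bulk indices of opposite parity (also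
one-prime-free rung data: all coordinates merely rough, cell of coordinate `i` prescribed — the
same BV + fundamental-lemma computation with `Ω(ψ_i(n)) = m`, valid for cells whose largest prime
factor exceeds `N^{2/u}`, i.e. all but the top cells of mass `≪ e^{-cu log u}`) pin `α_i = 1 + O(ε)`
and `β_i = O(ε)`; since `θ_∅ = 1` and `|θ_S| ≤ 2`, `β_i = θ_{i} + O(2^t ρ₁)` and
`|θ_{i}| ≤ O(ε) + 2^{t+1} ρ₁(u, N)`, with `ρ₁ → 0` as `u → ∞` by the parity balance of `Ω` on rough
integers (third clause of the route's `ModelCellFacts`, Alladi 1982 / Tenenbaum III.6). Provable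
now given the three hypotheses (M: linear algebra on `Finset (Fin t)` + the two model facts). -/
theorem cellParityLaw_singletonFree (hLaw : CellParityLaw) (hRung : ∀ t, 1 ≤ t → OnePrimeRung t)
    (hModel : ModelCellFacts) : CellParityLawSingletonFree := by
  sorry

/-- **What is left of the crux after the accessible face** (the honest open stub of the line):
the amplitudes `θ_S`, `|S| ≥ 2`. Given the law, `PrimeCellsRelative` is EQUIVALENT to
`Θ(1,…,1) = Σ_S θ_S → 1`, and at `w = (1,…,1)` the amplitude `θ_S` enters every accessible
coefficient with the weight `ρ₁^{|S|-1}` or `ρ₁^{|S|}` — invisible in the limit `u → ∞`. Typed as the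
implication the lead would have to staff (it is implied by `HyperbolicityClipsParity`'s hypotheses,
and by any rough-restricted parity-correlation input for pairs of forms). -/
def HigherAmplitudesVanish : Prop :=
  CellParityLawSingletonFree → PrimeCellsRelative

/-- Composition of the line `accessible-face` (pure logic, PROVED): law + rungs + model facts +
the binary stub give the crux. -/
theorem primeCellsRelative_of_accessibleFace (hLaw : CellParityLaw)
    (hRung : ∀ t, 1 ≤ t → OnePrimeRung t) (hModel : ModelCellFacts)
    (hHigh : HigherAmplitudesVanish) : PrimeCellsRelative :=
  hHigh (cellParityLaw_singletonFree hLaw hRung hModel)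

end Summit.Parity.GeneralizedHardyLittlewood.Cruxes.PrimeCellsRelative.Ideator2

end
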